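import Summits.QuantumFields.QCD.Theses.QuarksAsStableAction
import Summits.QuantumFields.QCD.Theses.WilsonQuarkChessboard
import Literature.MathematicalPhysics.QuantumLattice.WilsonDiracAP
import Literature.Probability.LatticeModels.TorusFourierProofs
import Summits.QuantumFields.QCD.Theorems.QuarksAsStableActionWilsonQuarkStabilityStubFreeTwistedFourierAux

/-!
# Stub `stub_freeTwistedFourier` of line `Sketch` (idea `free-tangent-landau-chessboard`)
(crux `Summit.QuantumFields.QCD.Theses.QuarksAsStableAction.WilsonQuarkStability`, item stmt-QuantumFields-9736,
route route-QuantumFields-QuarksAsStableAction)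

Torus-Fourier diagonalisation of the FREE `r = 1` Wilson–Dirac operator
`D = wilsonDirac ρ₃ (fun _ => ω) m 1` of the CONSTANT central `U(3)` link `ω = e^{iθ₀}·1` on `(ℤ/L)⁴`
(colour `Fin 3`, spin `Fin 4`, bare mass `m`; `θ₀ = π/L` is the antiperiodic seam twist in disguise).
Since `ρ(ω) = e^{iθ₀}·1` and `ρ(ω⁻¹) = e^{−iθ₀}·1`, the operator acts entrywise as
`(Dψ)(x,a,α) = (m+4)ψ − ½ Σ_μ Σ_β [(1 − γ_μ)_{αβ} e^{iθ₀} ψ(x+μ̂,a,β) + (1 + γ_μ)_{αβ} e^{−iθ₀} ψ(x−μ̂,a,β)]`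
(`wilsonDirac_twist_mulVec_apply`); on a plane wave `e^{iθ₀} χ_k(x + μ̂) = e^{iφ_μ} χ_k(x)` with the
SHIFTED angle `φ_μ = 2π k_μ.val / L + θ₀`, so `D (χ_k ⊗ e_b ⊗ e_β) = χ_k ⊗ e_b ⊗ M(k) e_β` with the
colour–spin symbol `M(k) = (m + Σ_μ (1 − cos φ_μ))·1 + iΣ_μ sin φ_μ γ_μ`
(`wilsonDirac_twist_mulVec_planeWave`), i.e. `D P = Q` for the unitary plane-wave matrix `P = F ⊗ 1`,
`F(x,k) = L⁻² χ_k(x)` (`wilsonDirac_twist_mul_planeP`).  The Clifford identity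
`M(k)ᴴ M(k) = h(k)·1`, `h(k) = (m + Σ_μ (1 − cos φ_μ))² + Σ_μ sin² φ_μ`
(`clifford_conjTranspose_mul_self`) and the generic inversion of the auxiliary file
(`det_ne_zero_of_planeWave`, `inv_gram_apply_of_planeWave`, `inv_apply_of_planeWave`) then give, for
`h > 0` on the grid: `det D ≠ 0`, `(DᴴD)⁻¹((x,s),(y,s')) = δ_{ss'} L⁻⁴ Σ_k χ_k(x) conj χ_k(y) / h(k)` and
`D⁻¹((x,a,α),(y,b,β)) = δ_{ab} L⁻⁴ Σ_k χ_k(x) conj χ_k(y) (M(k)ᴴ)_{αβ} / h(k)` (`stub_freeTwistedFourier`).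

References: Montvay–Münster, *Quantum Fields on a Lattice* §4.2 (free Wilson fermions in momentum
space; twisted / antiperiodic boundary conditions as a constant `U(1)` background); folklore.
Pure theorem file (no `def`s).
-/

namespace Summit.QuantumFields.QCD.Cruxes.WilsonQuarkStability.FreeTangentLandauChessboard

open Literature.MathematicalPhysics Literature.MathematicalPhysics.QuantumLattice
  Literature.MathematicalPhysics.QuantumFieldTheory Literature.Probability.LatticeModels
open Matrix Complex
open scoped Kronecker ComplexOrder ComplexConjugate BigOperators
open Summit.QuantumFields.QCD.Cruxes.TipNoBinding.PositivityNoLeakSpread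

noncomputable section

/-! ### The free twisted Wilson–Dirac operator on plane waves -/

section Concrete

variable {L : ℕ} [NeZero L]

/-- The adjoint (= inverse) of the constant central colour matrix `e^{iθ₀}·1` is `e^{−iθ₀}·1`. -/
theorem star_exp_smul_one (θ₀ : ℝ) :
    star (Complex.exp (θ₀ * I) • (1 : Matrix (Fin 3) (Fin 3) ℂ)) =
      Complex.exp (-(θ₀ * I)) • (1 : Matrix (Fin 3) (Fin 3) ℂ) := by
  rw [Matrix.star_eq_conjTranspose, conjTranspose_smul, conjTranspose_one, Complex.star_def,
    ← Complex.exp_conj, map_mul, Complex.conj_ofReal, Complex.conj_I, mul_neg]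

/-- **Entrywise action of the free twisted Wilson–Dirac operator** (`U ≡ ω = e^{iθ₀}·1`, `r = 1`,
mass `m`): `(Dψ)(x,a,α) = (m+4)ψ(x,a,α) − ½ Σ_μ Σ_β [(1 − γ_μ)_{αβ} e^{iθ₀} ψ(x+μ̂,a,β)
+ (1 + γ_μ)_{αβ} e^{−iθ₀} ψ(x−μ̂,a,β)]` (colour-diagonal since `ρ(ω) = e^{iθ₀}·1`). -/
theorem wilsonDirac_twist_mulVec_apply (θ₀ m : ℝ) (ω : Matrix.unitaryGroup (Fin 3) ℂ)
    (hω : (ω : Matrix (Fin 3) (Fin 3) ℂ) = Complex.exp (θ₀ * I) • (1 : Matrix (Fin 3) (Fin 3) ℂ))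
    (ψ : TorusSite 4 L × Fin 3 × Fin 4 → ℂ) (x : TorusSite 4 L) (a : Fin 3) (α : Fin 4) :
    (wilsonDirac (unitaryFundamentalRep (Fin 3) ℂ) (fun _ : Edge 4 L => ω) m 1 *ᵥ ψ) (x, a, α) =
      ((m + 4 : ℝ) : ℂ) * ψ (x, a, α) - (1 / 2) * ∑ μ, ∑ β,
        ((1 - euclideanGamma μ) α β * Complex.exp (θ₀ * I) * ψ (x + Pi.single μ 1, a, β) +
          (1 + euclideanGamma μ) α β * Complex.exp (-(θ₀ * I)) * ψ (x - Pi.single μ 1, a, β)) := by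
  have hf : ∀ μ : Fin 4, ∑ q : TorusSite 4 L × Fin 3 × Fin 4,
      (if q.1 = QuantumFieldTheory.Site.shift x μ then
          (1 - euclideanGamma μ) α q.2.2 *
            (Complex.exp (θ₀ * I) • (1 : Matrix (Fin 3) (Fin 3) ℂ)) a q.2.1 else 0) * ψ q =
        ∑ β, (1 - euclideanGamma μ) α β * Complex.exp (θ₀ * I) * ψ (x + Pi.single μ 1, a, β) := by
    intro μ
    rw [Fintype.sum_prod_type, Finset.sum_eq_single (QuantumFieldTheory.Site.shift x μ)]
    · rw [Fintype.sum_prod_type, Finset.sum_eq_single a]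
      · simp [QuantumFieldTheory.Site.shift]
      · intro b _ hb
        simp [Matrix.one_apply_ne (Ne.symm hb)]
      · simp
    · intro y _ hy
      simp [if_neg hy]
    · simp
  have hb : ∀ μ : Fin 4, ∑ q : TorusSite 4 L × Fin 3 × Fin 4,
      (if x = QuantumFieldTheory.Site.shift q.1 μ then
          (1 + euclideanGamma μ) α q.2.2 *
            (Complex.exp (-(θ₀ * I)) • (1 : Matrix (Fin 3) (Fin 3) ℂ)) a q.2.1 else 0) * ψ q =
        ∑ β, (1 + euclideanGamma μ) α β * Complex.exp (-(θ₀ * I)) * ψ (x - Pi.single μ 1, a, β) := by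
    intro μ
    simp_rw [eq_shift_iff]
    rw [Fintype.sum_prod_type, Finset.sum_eq_single (x - Pi.single μ 1)]
    · rw [Fintype.sum_prod_type, Finset.sum_eq_single a]
      · simp
      · intro b _ hb
        simp [Matrix.one_apply_ne (Ne.symm hb)]
      · simp
    · intro y _ hy
      simp [if_neg hy]
    · simp
  simp only [mulVec, dotProduct, wilsonDirac, of_apply, unitaryFundamentalRep_apply,
    Matrix.UnitaryGroup.inv_val, hω, star_exp_smul_one, Complex.ofReal_one, one_smul, sub_mul,
    Finset.sum_sub_distrib]
  congr 1
  · rw [Finset.sum_eq_single (x, a, α)]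
    · simp
    · intro q _ hq
      rw [if_neg (Ne.symm hq), zero_mul]
    · intro h; exact absurd (Finset.mem_univ _) h
  · simp_rw [Finset.mul_sum, Finset.sum_mul]
    rw [Finset.sum_comm]
    refine Finset.sum_congr rfl fun μ _ => ?_
    simp_rw [mul_assoc, ← Finset.mul_sum]
    congr 1
    simp_rw [add_mul, Finset.sum_add_distrib, hf, hb, mul_assoc]

/-- On a plane wave the twisted forward hop picks up `e^{iθ₀} χ_k(e_μ) = cos φ_μ + i sin φ_μ`,
`φ_μ = 2π k_μ.val / L + θ₀`. -/
theorem exp_mul_torusChar_single (θ₀ : ℝ) (k : TorusSite 4 L) (μ : Fin 4) :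
    Complex.exp (θ₀ * I) * torusChar k (Pi.single μ 1) =
      ((Real.cos (2 * Real.pi * ((k μ).val : ℝ) / L + θ₀) : ℝ) : ℂ) +
        ((Real.sin (2 * Real.pi * ((k μ).val : ℝ) / L + θ₀) : ℝ) : ℂ) * I := by
  rw [TipNoBinding.PositivityNoLeakSpread.torusChar_single_eq_exp, ← Complex.exp_add, Complex.ofReal_cos,
    Complex.ofReal_sin, ← Complex.exp_mul_I]
  congr 1
  push_cast
  ring

/-- On a plane wave the twisted backward hop picks up `e^{−iθ₀} conj χ_k(e_μ) = cos φ_μ − i sin φ_μ`,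
`φ_μ = 2π k_μ.val / L + θ₀`. -/
theorem exp_neg_mul_conj_torusChar_single (θ₀ : ℝ) (k : TorusSite 4 L) (μ : Fin 4) :
    Complex.exp (-(θ₀ * I)) * conj (torusChar k (Pi.single μ 1)) =
      ((Real.cos (2 * Real.pi * ((k μ).val : ℝ) / L + θ₀) : ℝ) : ℂ) -
        ((Real.sin (2 * Real.pi * ((k μ).val : ℝ) / L + θ₀) : ℝ) : ℂ) * I := by
  rw [TipNoBinding.PositivityNoLeakSpread.torusChar_single_eq_exp, ← Complex.exp_conj, ← Complex.exp_add,
    Complex.ofReal_cos, Complex.ofReal_sin, Complex.cos_sub_sin_I]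
  congr 1
  rw [map_mul, Complex.conj_ofReal, Complex.conj_I]
  push_cast
  ring

/-- Per direction `μ`, the two twisted hops of a plane wave combine to
`χ_k(x) · (2 cos φ_μ · δ_{αβ} − 2 i sin φ_μ · (γ_μ)_{αβ})`. -/
theorem twist_hop_planeWave (θ₀ : ℝ) (k x : TorusSite 4 L) (μ α β : Fin 4) :
    (1 - euclideanGamma μ) α β * Complex.exp (θ₀ * I) * torusChar k (x + Pi.single μ 1) +
        (1 + euclideanGamma μ) α β * Complex.exp (-(θ₀ * I)) * torusChar k (x - Pi.single μ 1) =
      torusChar k x *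
        (2 * ((Real.cos (2 * Real.pi * ((k μ).val : ℝ) / L + θ₀) : ℝ) : ℂ) *
            (1 : Matrix (Fin 4) (Fin 4) ℂ) α β -
          2 * (((Real.sin (2 * Real.pi * ((k μ).val : ℝ) / L + θ₀) : ℝ) : ℂ) * I) *
            euclideanGamma μ α β) := by
  rw [torusChar_add_right, torusChar_sub_right]
  calc (1 - euclideanGamma μ) α β * Complex.exp (θ₀ * I) * (torusChar k x * torusChar k (Pi.single μ 1)) +
        (1 + euclideanGamma μ) α β * Complex.exp (-(θ₀ * I)) *
          (torusChar k x * conj (torusChar k (Pi.single μ 1)))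
      = torusChar k x * ((1 - euclideanGamma μ) α β *
            (Complex.exp (θ₀ * I) * torusChar k (Pi.single μ 1)) +
          (1 + euclideanGamma μ) α β *
            (Complex.exp (-(θ₀ * I)) * conj (torusChar k (Pi.single μ 1)))) := by ring
    _ = _ := by
      rw [exp_mul_torusChar_single, exp_neg_mul_conj_torusChar_single, Matrix.sub_apply,
        Matrix.add_apply, Matrix.one_apply]
      split_ifs <;> ring

/-- **The free twisted Wilson–Dirac operator on a plane wave** (colour `b`, spin `β`, momentum `k`):
`D (χ_k ⊗ e_b ⊗ e_β) = χ_k ⊗ e_b ⊗ M(k) e_β` with the colour–spin symbol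
`M(k) = (m + W(k))·1 + i Σ_μ sin φ_μ γ_μ`, `W(k) = Σ_μ (1 − cos φ_μ)`, `φ_μ = 2π k_μ.val / L + θ₀`. -/
theorem wilsonDirac_twist_mulVec_planeWave (θ₀ m : ℝ) (ω : Matrix.unitaryGroup (Fin 3) ℂ)
    (hω : (ω : Matrix (Fin 3) (Fin 3) ℂ) = Complex.exp (θ₀ * I) • (1 : Matrix (Fin 3) (Fin 3) ℂ))
    (k : TorusSite 4 L) (b : Fin 3) (β : Fin 4) :
    wilsonDirac (unitaryFundamentalRep (Fin 3) ℂ) (fun _ : Edge 4 L => ω) m 1 *ᵥ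
        (fun l : TorusSite 4 L × Fin 3 × Fin 4 => torusChar k l.1 * if l.2 = (b, β) then 1 else 0) =
      fun p => torusChar k p.1 *
        if p.2.1 = b then
          ((((m + ∑ μ, (1 - Real.cos (2 * Real.pi * ((k μ).val : ℝ) / L + θ₀))) : ℝ) : ℂ) •
              (1 : Matrix (Fin 4) (Fin 4) ℂ) +
            I • ∑ μ, ((Real.sin (2 * Real.pi * ((k μ).val : ℝ) / L + θ₀) : ℝ) : ℂ) • euclideanGamma μ)
            p.2.2 β
        else 0 := by
  funext p
  obtain ⟨x, a, α⟩ := p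
  rw [wilsonDirac_twist_mulVec_apply θ₀ m ω hω]
  dsimp only
  by_cases hab : a = b
  · subst hab
    simp only [Prod.mk.injEq, true_and, if_true, mul_ite, mul_one, mul_zero, Finset.sum_add_distrib,
      Finset.sum_ite_eq', Finset.mem_univ]
    rw [← Finset.sum_add_distrib, Finset.sum_congr rfl fun μ _ => twist_hop_planeWave θ₀ k x μ α β]
    simp only [Matrix.add_apply, Matrix.smul_apply, smul_eq_mul, Matrix.one_apply, Fin.sum_univ_four]
    push_cast
    split_ifs <;> ring
  · simp only [Prod.mk.injEq, hab, false_and, if_false, mul_zero, add_zero, Finset.sum_const_zero,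
      sub_zero]

/-- **`D P = Q`**: on the plane-wave matrix `P = F ⊗ 1`, `F(x,k) = L⁻² χ_k(x)`, the free twisted operator
acts by the colour–spin symbol `1 ⊗ M(k)`, `M(k) = (m + Σ_μ (1 − cos φ_μ))·1 + i Σ_μ sin φ_μ γ_μ`. -/
theorem wilsonDirac_twist_mul_planeP (θ₀ m : ℝ) (ω : Matrix.unitaryGroup (Fin 3) ℂ)
    (hω : (ω : Matrix (Fin 3) (Fin 3) ℂ) = Complex.exp (θ₀ * I) • (1 : Matrix (Fin 3) (Fin 3) ℂ)) :
    wilsonDirac (unitaryFundamentalRep (Fin 3) ℂ) (fun _ : Edge 4 L => ω) m 1 *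
        ((Matrix.of fun x k : TorusSite 4 L => ((L : ℂ) ^ 2)⁻¹ * torusChar k x) ⊗ₖ
          (1 : Matrix (Fin 3 × Fin 4) (Fin 3 × Fin 4) ℂ)) =
      Matrix.of fun p q : TorusSite 4 L × Fin 3 × Fin 4 =>
        (Matrix.of fun x k : TorusSite 4 L => ((L : ℂ) ^ 2)⁻¹ * torusChar k x) p.1 q.1 *
          ((1 : Matrix (Fin 3) (Fin 3) ℂ) ⊗ₖ
            ((((m + ∑ μ, (1 - Real.cos (2 * Real.pi * ((q.1 μ).val : ℝ) / L + θ₀))) : ℝ) : ℂ) •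
                (1 : Matrix (Fin 4) (Fin 4) ℂ) +
              I • ∑ μ, ((Real.sin (2 * Real.pi * ((q.1 μ).val : ℝ) / L + θ₀) : ℝ) : ℂ) • euclideanGamma μ))
            p.2 q.2 := by
  ext p q
  have hcol : (fun l : TorusSite 4 L × Fin 3 × Fin 4 =>
      ((Matrix.of fun x k : TorusSite 4 L => ((L : ℂ) ^ 2)⁻¹ * torusChar k x) ⊗ₖ
        (1 : Matrix (Fin 3 × Fin 4) (Fin 3 × Fin 4) ℂ)) l q) =
      ((L : ℂ) ^ 2)⁻¹ • fun l => torusChar q.1 l.1 * if l.2 = (q.2.1, q.2.2) then 1 else 0 := by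
    funext l
    rw [Pi.smul_apply, smul_eq_mul, Matrix.kroneckerMap_apply, Matrix.of_apply, Matrix.one_apply,
      Prod.mk.eta, mul_assoc]
  rw [Matrix.mul_apply', dotProduct, show (∑ l, wilsonDirac (unitaryFundamentalRep (Fin 3) ℂ)
      (fun _ : Edge 4 L => ω) m 1 p l *
      ((Matrix.of fun x k : TorusSite 4 L => ((L : ℂ) ^ 2)⁻¹ * torusChar k x) ⊗ₖ
        (1 : Matrix (Fin 3 × Fin 4) (Fin 3 × Fin 4) ℂ)) l q) =
      (wilsonDirac (unitaryFundamentalRep (Fin 3) ℂ) (fun _ : Edge 4 L => ω) m 1 *ᵥ fun l =>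
        ((Matrix.of fun x k : TorusSite 4 L => ((L : ℂ) ^ 2)⁻¹ * torusChar k x) ⊗ₖ
        (1 : Matrix (Fin 3 × Fin 4) (Fin 3 × Fin 4) ℂ)) l q) p from rfl,
    hcol, Matrix.mulVec_smul, Pi.smul_apply, wilsonDirac_twist_mulVec_planeWave θ₀ m ω hω, smul_eq_mul,
    Matrix.of_apply, Matrix.of_apply, Matrix.kroneckerMap_apply, Matrix.one_apply, ite_mul, one_mul,
    zero_mul, mul_assoc]

end Concrete

/-- **Stub `stub_freeTwistedFourier`.**  Fourier diagonalisation of the free `r = 1` Wilson–Dirac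
operator `D` of the CONSTANT central `U(3)` field `ω = e^{iθ₀}·1` on `(ℤ/L)⁴`, bare mass `m`: with
`φ_μ = 2π k_μ.val / L + θ₀`, `h(k) = (m + Σ_μ (1 − cos φ_μ))² + Σ_μ sin² φ_μ` and
`M(k) = (m + Σ_μ (1 − cos φ_μ))·1 + iΣ_μ sin φ_μ γ_μ`, if `h > 0` on the momentum grid then
`det D ≠ 0`, `(DᴴD)⁻¹((x,s),(y,s')) = δ_{ss'} L⁻⁴ Σ_k χ_k(x) conj χ_k(y) / h(k)` and
`D⁻¹((x,a,α),(y,b,β)) = δ_{ab} L⁻⁴ Σ_k χ_k(x) conj χ_k(y) (M(k)ᴴ)_{αβ} / h(k)`. -/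
theorem stub_freeTwistedFourier :
  ∀ (L : ℕ) [NeZero L] (θ₀ m : ℝ) (ω : Matrix.unitaryGroup (Fin 3) ℂ),
    (ω : Matrix (Fin 3) (Fin 3) ℂ) = Complex.exp (θ₀ * I) • (1 : Matrix (Fin 3) (Fin 3) ℂ) →
    let φ : TorusSite 4 L → Fin 4 → ℝ := fun k μ => 2 * Real.pi * ((k μ).val : ℝ) / L + θ₀
    let h : TorusSite 4 L → ℝ := fun k =>
      (m + ∑ μ, (1 - Real.cos (φ k μ))) ^ 2 + ∑ μ, Real.sin (φ k μ) ^ 2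
    let M : TorusSite 4 L → Matrix (Fin 4) (Fin 4) ℂ := fun k =>
      (((m + ∑ μ, (1 - Real.cos (φ k μ)) : ℝ) : ℂ)) • (1 : Matrix (Fin 4) (Fin 4) ℂ) +
        I • ∑ μ, ((Real.sin (φ k μ) : ℝ) : ℂ) • euclideanGamma μ
    let D := wilsonDirac (unitaryFundamentalRep (Fin 3) ℂ) (fun _ : Edge 4 L => ω) m 1
    (∀ k, 0 < h k) →
      D.det ≠ 0 ∧
      (∀ p q : TorusSite 4 L × Fin 3 × Fin 4, (Dᴴ * D)⁻¹ p q =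
        if p.2 = q.2 then ((L : ℂ) ^ 4)⁻¹ * ∑ k, torusChar k p.1 * conj (torusChar k q.1) / ((h k : ℝ) : ℂ)
        else 0) ∧
      (∀ p q : TorusSite 4 L × Fin 3 × Fin 4, D⁻¹ p q =
        if p.2.1 = q.2.1 then
          ((L : ℂ) ^ 4)⁻¹ * ∑ k, torusChar k p.1 * conj (torusChar k q.1) * (M k)ᴴ p.2.2 q.2.2 / ((h k : ℝ) : ℂ)
        else 0) := by
  intro L _ θ₀ m ω hω
  dsimp only
  intro hpos
  have hN : ∀ k : TorusSite 4 L,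
      ((((m + ∑ μ, (1 - Real.cos (2 * Real.pi * ((k μ).val : ℝ) / L + θ₀))) : ℝ) : ℂ) •
            (1 : Matrix (Fin 4) (Fin 4) ℂ) +
          I • ∑ μ, ((Real.sin (2 * Real.pi * ((k μ).val : ℝ) / L + θ₀) : ℝ) : ℂ) • euclideanGamma μ)ᴴ *
        ((((m + ∑ μ, (1 - Real.cos (2 * Real.pi * ((k μ).val : ℝ) / L + θ₀))) : ℝ) : ℂ) •
            (1 : Matrix (Fin 4) (Fin 4) ℂ) +
          I • ∑ μ, ((Real.sin (2 * Real.pi * ((k μ).val : ℝ) / L + θ₀) : ℝ) : ℂ) • euclideanGamma μ) =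
      (((m + ∑ μ, (1 - Real.cos (2 * Real.pi * ((k μ).val : ℝ) / L + θ₀))) ^ 2 +
          ∑ μ, Real.sin (2 * Real.pi * ((k μ).val : ℝ) / L + θ₀) ^ 2 : ℝ) : ℂ) •
        (1 : Matrix (Fin 4) (Fin 4) ℂ) :=
    fun k => clifford_conjTranspose_mul_self _ _
  have hd0 : ∀ k : TorusSite 4 L,
      (m + ∑ μ, (1 - Real.cos (2 * Real.pi * ((k μ).val : ℝ) / L + θ₀))) ^ 2 +
        ∑ μ, Real.sin (2 * Real.pi * ((k μ).val : ℝ) / L + θ₀) ^ 2 ≠ 0 := fun k => (hpos k).ne'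
  have hA := wilsonDirac_twist_mul_planeP (L := L) θ₀ m ω hω
  exact ⟨det_ne_zero_of_planeWave _ _ hN hd0 _ hA, inv_gram_apply_of_planeWave _ _ hN hd0 _ hA,
    inv_apply_of_planeWave _ _ hN hd0 _ hA⟩

end

end Summit.QuantumFields.QCD.Cruxes.WilsonQuarkStability.FreeTangentLandauChessboard

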